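import Summits.ABC.IUTFork.Repair.RHSlotReachSigma
import HarnessLib

/-!
# R-H ROUND 2, Q2(15)/Q3: membership in Σ₁₅ in the INTEGER CELL CURRENCY of I06STAR-COLUMNS (uniform fibres, realising profile)

PROOF-ONLY companion (0 definitions) of `Repair/RHSlotReachSigma.lean` (p467478; typer abc-iut-rh-typ-12, director-abc g3 TRANCHE 1 19:46:32Z).
For the round-2 numerics/typing seats (rh2-q3-num, rh2-q3-typ-1, rh2-q2-hull): on a fibre with UNIFORM certified data `(e_p, A_p, B_p)` (every HEX /
G-HEX row: `K/ℚ` Galois) and the realising Θ-profile `mΘ(j, w) = j²·mq(w)` ([IUTchI] Ex. 3.2 (iv)), the packet clause `SlotReachPacket … p i` — i.e.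
membership of the cell `(i, p)` in Σ₁₅ = `sigmaSlotReach` — is EXACTLY the integer cell of the round-1 k1 engines at every bad `w ∣ p`:
`e_p·⌊(j²·mq(w) − A_p)/e_p⌋ ≤ mq(w) − B_p + j·(e_p·⌈A_p/e_p⌉ − B_p)`, `j = i+1` (`slotReachPacket_iff_cells_of_uniform`,
`mem_sigmaSlotReach_inr_iff_cells_of_uniform`; the all-cells form is abc-iut-rh-typ-12 g0's `slotReachWindowK_iff_cells_of_uniform`, p457641 §3).
So «datum ∈ Σ₁₅ at (j, p)» is a decidable integer statement in the columns `(e_w, m_q, j, A, B)` — the object Q3 («genuine data in Σ for l ≫ 0?»)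
quantifies over `l`. TAKES NO SIDE on [IUTchIII] Cor. 3.12 or on any author; Σ₁₅ is a hypothesis shape; typed ≠ proved; instantiated ≠ endorsed.
[cite: Mochizuki2012, IUTchI Ex. 3.2 (iv) p. 71; IUTchIII Cor. 3.12 Step (xi-f) p. 184] [claim: Mochizuki2012, status: disputed] for every IUT locution.
-/

noncomputable section

open Set Function Metric NumberField IsDedekindDomain
open scoped Pointwise

namespace Summit.ABC.IUTFork.Repair.RHSlotReach

open Thm311 Thm311.Real Cor312 Cor312.Setting Cor312Vol Literature.IUT.LogThetaLattice Literature.IUT.LogVolume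
open Literature.NumberTheory.NumberFields

/-- **THE PACKET CLAUSE IN INTEGER CELL CURRENCY (uniform fibre, realising profile).** With `e x = e_p ≥ 1`, `n₀ x = A_p`, `λ x = −B_p/e_p` at every
place over `p` and `mΘ(i, w) = (i+1)²·mq(w)`: `SlotReachPacket … p i ↔ ∀ bad w ∣ p, e_p·⌊((i+1)²·mq(w) − A_p)/e_p⌋ ≤ mq(w) − B_p + (i+1)·(e_p·⌈A_p/e_p⌉ − B_p)`
(the donor tuple is immaterial on a uniform fibre; `⌈A/e⌉ = −⌊−A/e⌋`). [cite: Mochizuki2012, IUTchI Ex. 3.2 (iv) p. 71] [claim: Mochizuki2012, status: disputed] -/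
theorem slotReachPacket_iff_cells_of_uniform (lstar : ℕ) (Fib : Nat.Primes → Type) (bad : ∀ pp, Fib pp → Prop)
    (eK AK : Nat.Primes → ℕ) (BK : Nat.Primes → ℤ) (heK : ∀ pp, 1 ≤ eK pp)
    (e n₀ : ∀ pp, Fib pp → ℕ) (lam : ∀ pp, Fib pp → ℝ) (mΘ : ∀ pp, Fin lstar → Fib pp → ℤ) (mq : ∀ pp, Fib pp → ℤ)
    (he : ∀ pp x, e pp x = eK pp) (hn₀ : ∀ pp x, n₀ pp x = AK pp)
    (hlam : ∀ pp x, lam pp x = -((BK pp : ℤ) : ℝ) / ((eK pp : ℕ) : ℝ))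
    (hmΘ : ∀ pp i w, mΘ pp i w = ((((i : ℕ) : ℤ) + 1) ^ 2) * mq pp w) (pp : Nat.Primes) (i : Fin lstar) :
    SlotReachPacket lstar Fib bad e n₀ lam mΘ mq pp i ↔
      ∀ w : Fib pp, bad pp w →
        (eK pp : ℤ) * ((((((i : ℕ) : ℤ) + 1) ^ 2) * mq pp w - AK pp) / (eK pp : ℤ)) ≤
          mq pp w - BK pp + (((i : ℕ) + 1 : ℕ) : ℤ) * ((eK pp : ℤ) * (-((-(AK pp : ℤ)) / (eK pp : ℤ))) - BK pp) := by
  unfold SlotReachPacket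
  refine forall_congr' fun w => forall_congr' fun _ => ?_
  simp only [he, hn₀, hlam, hmΘ]
  rw [← clause_iff_uniform (eK pp) (heK pp) (AK pp) (BK pp) (i : ℕ) _ (mq pp w)]
  exact ⟨fun h => h fun _ => w, fun h _ => h⟩

section Sigma

variable {F : Type} [Field F] [NumberField F] (X : PilotData F)
  (eK AK : Nat.Primes → ℕ) (BK : Nat.Primes → ℤ) (heK : ∀ pp, 1 ≤ eK pp)
  (e n₀ : ∀ pp : Nat.Primes, (thetaIndex X).Fibre (.inr pp) → ℕ)
  (lam : ∀ pp : Nat.Primes, (thetaIndex X).Fibre (.inr pp) → ℝ)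
  (mΘ : ∀ pp : Nat.Primes, Fin (thetaIndex X).lstar → (thetaIndex X).Fibre (.inr pp) → ℤ)
  (mq : ∀ pp : Nat.Primes, (thetaIndex X).Fibre (.inr pp) → ℤ)

include heK in
/-- **MEMBERSHIP OF A CELL `(i, p)` IN Σ₁₅ = THE INTEGER CELLS AT THE BAD PLACES OVER `p`** (uniform fibres, realising profile): the k1-evaluable
form of `sigmaSlotReach` for the round-2 tables (columns `e_w`, `m_q = e_w·H/(2l)`, `j`, certified `(A, B)`). [claim: Mochizuki2012, status: disputed] -/
theorem mem_sigmaSlotReach_inr_iff_cells_of_uniform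
    (he : ∀ pp x, e pp x = eK pp) (hn₀ : ∀ pp x, n₀ pp x = AK pp)
    (hlam : ∀ pp x, lam pp x = -((BK pp : ℤ) : ℝ) / ((eK pp : ℕ) : ℝ))
    (hmΘ : ∀ pp i w, mΘ pp i w = ((((i : ℕ) : ℤ) + 1) ^ 2) * mq pp w)
    (i : Fin (thetaIndex X).lstar) (pp : Nat.Primes) :
    (i, (.inr pp : (thetaIndex X).VQ)) ∈ sigmaSlotReach X e n₀ lam mΘ mq ↔
      ∀ w : (thetaIndex X).Fibre (.inr pp), (haveI : Fact (pp : ℕ).Prime := ⟨pp.2⟩; placeOf X pp.1 w ∈ X.S) →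
        (eK pp : ℤ) * ((((((i : ℕ) : ℤ) + 1) ^ 2) * mq pp w - AK pp) / (eK pp : ℤ)) ≤
          mq pp w - BK pp + (((i : ℕ) + 1 : ℕ) : ℤ) * ((eK pp : ℤ) * (-((-(AK pp : ℤ)) / (eK pp : ℤ))) - BK pp) := by
  rw [mem_sigmaSlotReach_inr_iff, slotReachPacket_iff_cells_of_uniform _ _ _ eK AK BK heK e n₀ lam mΘ mq he hn₀ hlam hmΘ]

include heK in
/-- **A DATUM LIES IN Σ₁₅ (datum-level reading: Σ₁₅ = all cells) IFF EVERY integer cell at every bad place and label holds** (uniform fibres,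
realising profile) — the all-cells form, equivalently `SlotReachWindow` (abc-iut-rh-typ-12 g0 `slotReachWindowK_iff_cells_of_uniform` at the
genuine `K`-datum). [claim: Mochizuki2012, status: disputed] -/
theorem sigmaSlotReach_eq_univ_iff_cells_of_uniform
    (he : ∀ pp x, e pp x = eK pp) (hn₀ : ∀ pp x, n₀ pp x = AK pp)
    (hlam : ∀ pp x, lam pp x = -((BK pp : ℤ) : ℝ) / ((eK pp : ℕ) : ℝ))
    (hmΘ : ∀ pp i w, mΘ pp i w = ((((i : ℕ) : ℤ) + 1) ^ 2) * mq pp w) :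
    sigmaSlotReach X e n₀ lam mΘ mq = Set.univ ↔
      ∀ (pp : Nat.Primes) (i : Fin (thetaIndex X).lstar) (w : (thetaIndex X).Fibre (.inr pp)),
        (haveI : Fact (pp : ℕ).Prime := ⟨pp.2⟩; placeOf X pp.1 w ∈ X.S) →
          (eK pp : ℤ) * ((((((i : ℕ) : ℤ) + 1) ^ 2) * mq pp w - AK pp) / (eK pp : ℤ)) ≤
            mq pp w - BK pp + (((i : ℕ) + 1 : ℕ) : ℤ) * ((eK pp : ℤ) * (-((-(AK pp : ℤ)) / (eK pp : ℤ))) - BK pp) := by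
  constructor
  · intro h pp i
    have hmem : (i, (.inr pp : (thetaIndex X).VQ)) ∈ sigmaSlotReach X e n₀ lam mΘ mq := by rw [h]; exact Set.mem_univ _
    exact (mem_sigmaSlotReach_inr_iff_cells_of_uniform X eK AK BK heK e n₀ lam mΘ mq he hn₀ hlam hmΘ i pp).1 hmem
  · intro h
    refine Set.eq_univ_of_forall fun c => ?_
    obtain ⟨i, vQ⟩ := c
    intro pp hpp
    cases hpp
    exact (slotReachPacket_iff_cells_of_uniform _ _ _ eK AK BK heK e n₀ lam mΘ mq he hn₀ hlam hmΘ pp i).2 (h pp i)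

end Sigma

/-! ## §3. SLICE (round 2, human ask (A)): at the CERTIFIED dictionary `A = 1`, the POS labels of the row-15 cell form an INITIAL SEGMENT
`{1, …, j₀⁽¹⁵⁾(w)}` with `j₀⁽⁸⁾(w) ≤ j₀⁽¹⁵⁾(w) ≤ j₀⁽⁸⁾(w) + 1` — no sporadic labels (abc-iut-rh-typ-12 g3, for `plan/rescue/R-H/SLICE.md` row 15)

Integer currency (one bad place `w ∣ p`, uniform fibre): `e = e_w ≥ 1`, `mq = m_q(w) ≥ 1`, outer certificate `B ≤ 1` (`B = r♯ = rOutSharp p e ≤ 1`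
at untied places; NOT the tie fallback `B = e`), label `j ≥ 1`. The three cells, spelled out (no definitions):
* row 15 at `A = 1` (`clause_iff_uniform`, `⌈1/e⌉ = 1`): `POS(j) :⟺ e·⌊(j²·mq − 1)/e⌋ ≤ mq − B + j·(e − B)`;
* row 8's band (`RHHeightClass.HBand`, integer form): `HB(j) :⟺ (j² − 1)·mq ≤ j·(e − B) + (1 − B)`;
* the floor-free NECESSARY bound: `WK(j) :⟺ (j² − 1)·mq ≤ j·(e − B) + (e − B)`.
Sandwich `HB(j) ⟹ POS(j) ⟹ WK(j)` (`x − (e−1) ≤ e⌊x/e⌋ ≤ x`). KEY STEP (`not_weakCell_of_not_hBandCell_lt`): if `HB` fails at `j ≥ 1` then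
`j·mq > e − B`, hence `WK` fails at EVERY `k ≥ j + 1` (the quadratic gains `(2k+1)·mq > 2(e − B)` per step against a window of height
`e − 1 < e − B + 1`). Consequences: `POS` is downward closed in `j` (`slotCell_initialSegment`), `POS(j) ⟹ HB(j − 1)` for `j ≥ 2`
(`hBandCell_pred_of_slotCell`), `POS(1)` always (`slotCell_one`): the row-15 slice at a place is `{1, …, j₀}` with `j₀ ∈ {j₀⁽⁸⁾, j₀⁽⁸⁾ + 1}` —
the «+1» labels are exactly the 40 groups on which row 15 ⊋ row 8 in the round-1 tables (HOME/abc-iut-rh-typ-12/HANDOFF.md (t3)), and the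
5,140/5,140 initial segments of the k1 engines are a theorem, not a table fact. Pure `ℤ` arithmetic; nothing about any bed. [folklore] -/

section Slice

/-- `⌈1/e⌉ = −⌊−1/e⌋ = 1` for `e ≥ 1` (Lean's `ℤ`-division is floor for a positive divisor). [folklore] -/
theorem neg_neg_one_ediv_eq_one (e : ℕ) (he : 1 ≤ e) : -((-(1 : ℤ)) / (e : ℤ)) = 1 := by
  have h := (Int.ediv_emod_unique (a := -1) (b := (e : ℤ)) (r := (e : ℤ) - 1) (q := -1)
    (by exact_mod_cast he)).2 ⟨by ring, by omega, by omega⟩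
  rw [h.1]; rfl

/-- **The `A = 1` cell of `slotReachPacket_iff_cells_of_uniform` / `mem_sigmaSlotReach_inr_iff_cells_of_uniform` in the short form used
below**: `e·⌊(X − 1)/e⌋ ≤ mq − B + J·(e·⌈1/e⌉ − B) ⟺ e·⌊(X − 1)/e⌋ ≤ mq − B + J·(e − B)`. [folklore] -/
theorem slotCell_A_one_iff (e : ℕ) (he : 1 ≤ e) (B mq X J : ℤ) :
    (e : ℤ) * ((X - ((1 : ℕ) : ℤ)) / (e : ℤ)) ≤ mq - B + J * ((e : ℤ) * (-((-((1 : ℕ) : ℤ)) / (e : ℤ))) - B) ↔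
      (e : ℤ) * ((X - 1) / (e : ℤ)) ≤ mq - B + J * ((e : ℤ) - B) := by
  rw [Nat.cast_one, neg_neg_one_ediv_eq_one e he, mul_one]

/-- **Row 8's band cell implies the row-15 cell** (`e·⌊x/e⌋ ≤ x`; `Σ₈ ⊆ Σ₁₅` cellwise, the integer shadow of abc-iut-rp-m2's p460910).
[folklore] -/
theorem slotCell_of_hBandCell (e : ℕ) (he : 1 ≤ e) (B mq : ℤ) (j : ℕ)
    (h : ((j : ℤ) ^ 2 - 1) * mq ≤ (j : ℤ) * ((e : ℤ) - B) + (1 - B)) :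
    (e : ℤ) * (((j : ℤ) ^ 2 * mq - 1) / (e : ℤ)) ≤ mq - B + (j : ℤ) * ((e : ℤ) - B) := by
  have h1 := mul_ediv_le_self (e := (e : ℤ)) (by exact_mod_cast he) ((j : ℤ) ^ 2 * mq - 1)
  linarith

/-- **The row-15 cell implies the floor-free necessary bound** (`x − (e − 1) ≤ e·⌊x/e⌋`). [folklore] -/
theorem weakCell_of_slotCell (e : ℕ) (he : 1 ≤ e) (B mq : ℤ) (j : ℕ)
    (h : (e : ℤ) * (((j : ℤ) ^ 2 * mq - 1) / (e : ℤ)) ≤ mq - B + (j : ℤ) * ((e : ℤ) - B)) :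
    ((j : ℤ) ^ 2 - 1) * mq ≤ (j : ℤ) * ((e : ℤ) - B) + ((e : ℤ) - B) := by
  have hm := Int.mul_ediv_add_emod ((j : ℤ) ^ 2 * mq - 1) (e : ℤ)
  have hlt := Int.emod_lt_of_pos ((j : ℤ) ^ 2 * mq - 1) (show (0 : ℤ) < (e : ℤ) by exact_mod_cast he)
  linarith

/-- **The `j = 1` cell always holds** (`B ≤ 1`, `e ≥ 1`): the label `j = 1` is in every slice. [folklore] -/
theorem slotCell_one (e : ℕ) (he : 1 ≤ e) {B : ℤ} (hB : B ≤ 1) (mq : ℤ) :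
    (e : ℤ) * ((((1 : ℕ) : ℤ) ^ 2 * mq - 1) / (e : ℤ)) ≤ mq - B + ((1 : ℕ) : ℤ) * ((e : ℤ) - B) := by
  have h1 := mul_ediv_le_self (e := (e : ℤ)) (by exact_mod_cast he) ((((1 : ℕ) : ℤ)) ^ 2 * mq - 1)
  have he' : (1 : ℤ) ≤ (e : ℤ) := by exact_mod_cast he
  simp only [Nat.cast_one, one_pow, one_mul] at h1 ⊢
  linarith

/-- **KEY STEP: once row 8's band fails at a label `j ≥ 1`, the floor-free necessary bound fails at EVERY later label `k ≥ j + 1`**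
(`mq ≥ 1`, `B ≤ 1`): from `¬HB(j)` one gets `j·mq > e − B`, so each step `k ↦ k + 1` adds `(2k+1)·mq > 2(e − B) + 1` to the left side
against `e − B` on the right, and the first step already clears the window `e − 1`. [folklore] -/
theorem not_weakCell_of_not_hBandCell_lt (e : ℕ) {B mq : ℤ} (hB : B ≤ 1) (hmq : 1 ≤ mq) {j k : ℕ} (hjk : j + 1 ≤ k)
    (h : ¬ ((j : ℤ) ^ 2 - 1) * mq ≤ (j : ℤ) * ((e : ℤ) - B) + (1 - B)) :
    ¬ ((k : ℤ) ^ 2 - 1) * mq ≤ (k : ℤ) * ((e : ℤ) - B) + ((e : ℤ) - B) := by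
  push Not at h ⊢
  have hj0 : (0 : ℤ) ≤ (j : ℤ) := by positivity
  have he0 : (0 : ℤ) ≤ (e : ℤ) := by positivity
  -- step 1: `j·mq > e − B`
  have hjm : (e : ℤ) - B < (j : ℤ) * mq := by
    by_contra hc
    push Not at hc
    have hmul : (j : ℤ) * ((j : ℤ) * mq) ≤ (j : ℤ) * ((e : ℤ) - B) := mul_le_mul_of_nonneg_left hc hj0
    nlinarith
  -- step 2: induction on `k = j + 1 + d`
  obtain ⟨d, rfl⟩ : ∃ d, k = j + 1 + d := ⟨k - (j + 1), by omega⟩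
  induction d with
  | zero =>
    push_cast
    nlinarith
  | succ d ih =>
    have ih' := ih (by omega)
    have hcast : ((j + 1 + (d + 1) : ℕ) : ℤ) = ((j + 1 + d : ℕ) : ℤ) + 1 := by push_cast; ring
    rw [hcast]
    have hkj : (j : ℤ) + 1 ≤ ((j + 1 + d : ℕ) : ℤ) := by push_cast; linarith
    have hkm : ((j : ℤ) + 1) * mq ≤ ((j + 1 + d : ℕ) : ℤ) * mq := mul_le_mul_of_nonneg_right hkj (by linarith)
    nlinarith

/-- **THE ROW-15 SLICE IS AN INITIAL SEGMENT** (`mq ≥ 1`, `B ≤ 1`): if the cell holds at a label `j₂` it holds at every label `1 ≤ j₁ ≤ j₂`.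
(`¬POS(j₁) ⟹ ¬HB(j₁) ⟹ ¬WK(j₂) ⟹ ¬POS(j₂)`.) [folklore] -/
theorem slotCell_initialSegment (e : ℕ) (he : 1 ≤ e) {B mq : ℤ} (hB : B ≤ 1) (hmq : 1 ≤ mq) {j₁ j₂ : ℕ}
    (hle : j₁ ≤ j₂) (h₂ : (e : ℤ) * (((j₂ : ℤ) ^ 2 * mq - 1) / (e : ℤ)) ≤ mq - B + (j₂ : ℤ) * ((e : ℤ) - B)) :
    (e : ℤ) * (((j₁ : ℤ) ^ 2 * mq - 1) / (e : ℤ)) ≤ mq - B + (j₁ : ℤ) * ((e : ℤ) - B) := by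
  by_contra h₁
  have hnb : ¬ ((j₁ : ℤ) ^ 2 - 1) * mq ≤ (j₁ : ℤ) * ((e : ℤ) - B) + (1 - B) :=
    fun hb => h₁ (slotCell_of_hBandCell e he B mq j₁ hb)
  rcases Nat.eq_or_lt_of_le hle with heq | hlt
  · subst heq; exact h₁ h₂
  · exact not_weakCell_of_not_hBandCell_lt e hB hmq (by omega) hnb (weakCell_of_slotCell e he B mq j₂ h₂)

/-- **`j₀⁽¹⁵⁾ ≤ j₀⁽⁸⁾ + 1`**: if the row-15 cell holds at a label `j ≥ 2` then row 8's band holds at `j − 1` (`mq ≥ 1`, `B ≤ 1`). With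
`slotCell_of_hBandCell` (`j₀⁽⁸⁾ ≤ j₀⁽¹⁵⁾`) and `slotCell_initialSegment`: the slice is `{1, …, j₀}` with `j₀ ∈ {j₀⁽⁸⁾, j₀⁽⁸⁾ + 1}`. [folklore] -/
theorem hBandCell_pred_of_slotCell (e : ℕ) (he : 1 ≤ e) {B mq : ℤ} (hB : B ≤ 1) (hmq : 1 ≤ mq) {j : ℕ} (hj : 2 ≤ j)
    (h : (e : ℤ) * (((j : ℤ) ^ 2 * mq - 1) / (e : ℤ)) ≤ mq - B + (j : ℤ) * ((e : ℤ) - B)) :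
    ((((j - 1 : ℕ) : ℤ)) ^ 2 - 1) * mq ≤ ((j - 1 : ℕ) : ℤ) * ((e : ℤ) - B) + (1 - B) := by
  by_contra hnb
  exact not_weakCell_of_not_hBandCell_lt e hB hmq (j := j - 1) (k := j) (by omega) hnb
    (weakCell_of_slotCell e he B mq j h)

/-- Sanity cell (`p = 7`, `e = 13`, `B = r♯ = −6`, `mq = 16`): row 8's band FAILS at `j = 2` (`48 > 45`) while the row-15 cell HOLDS there
(`13·⌊63/13⌋ = 52 ≤ 60`) and fails at `j = 3` (`143 > 79`) — a «+1» label (`j₀⁽⁸⁾ = 1`, `j₀⁽¹⁵⁾ = 2`), as in the tables (`15 ⊋ 8`). -/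
example : ¬ ((((2 : ℕ) : ℤ)) ^ 2 - 1) * 16 ≤ ((2 : ℕ) : ℤ) * (((13 : ℕ) : ℤ) - (-6)) + (1 - (-6)) ∧
    ((13 : ℕ) : ℤ) * ((((2 : ℕ) : ℤ) ^ 2 * 16 - 1) / ((13 : ℕ) : ℤ)) ≤ 16 - (-6) + ((2 : ℕ) : ℤ) * (((13 : ℕ) : ℤ) - (-6)) ∧
    ¬ ((13 : ℕ) : ℤ) * ((((3 : ℕ) : ℤ) ^ 2 * 16 - 1) / ((13 : ℕ) : ℤ)) ≤ 16 - (-6) + ((3 : ℕ) : ℤ) * (((13 : ℕ) : ℤ) - (-6)) := by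
  decide

end Slice

end Summit.ABC.IUTFork.Repair.RHSlotReach

end
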